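import Summits.BirchSwinnertonDyer.BirchSwinnertonDyer.Theorems.EisensteinPrimesSurLambdaCaseCTCOfPoitouTate
import Literature.NumberTheory.IwasawaTheory.Greenberg2016.DualShaTorsionOfPoitouTateAt
import HarnessLib

/-!
# Road «SUR-Λ» END-COMPOSE on the FINITE-`Σ` instance of the Ш-duality it reads:
# `(∀ K totally complex, ∀ S finite, poitouTate_shaRestricted_tateDual_natural_at K S) ⟹ prop263_sur_of_crk_caseC_tc`

Cell `bsd-eis` (run/shared/lean/pub/bsd-eis/), LEAD seat `bsd-line-x1-p1` gen 10; crux 2 `GoodLatticeBDPValue`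
(stmt-BirchSwinnertonDyer-19032), line `halves`; `--supports stmt-BirchSwinnertonDyer-19032` (helper).  THEOREMS
ONLY (no definition, no named fact, no `sorry`).

Width seat w5 gen 9's END theorem `SurLambda.prop263_sur_of_crk_caseC_tc_of_poitouTateNatural` (p706004) takes
the textbook named fact for EVERY set of places (`∀ K [IsTotallyComplex K], poitouTate_shaRestricted_tateDual_natural K`,
i.e. `∀ K ∀ S : Set _, …`), but `prop263_sur_of_crk_caseC_tc` binds `(S : Set _), S.Finite →` and the proof
uses the duality at that one finite `S`.  This file re-types the END theorem on EXACTLY that instance —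
`hX : ∀ (K) [IsTotallyComplex K] (S), S.Finite → poitouTate_shaRestricted_tateDual_natural_at K S`
(`PoitouTateRestrictedRamificationNaturalAt.lean`; consumer `Greenberg2016.dualSha_torsion_of_poitouTateNaturalAt`) —
which is (i) what halves v32 carries by name (a faithfulness narrowing of v31's conjunct: the SAME
theorem, Milne ADT I 4.10 (a), at the instances read) and (ii) the END statement of the background lane
«PT-Ш-S-TC» (finite-`S` engine on `IdeleClassBar.classBarSD K (S : Finset _)`), whose landing turns `hX`
into a theorem (v33).  p706004's statement follows from this one at `fun K _ _ _ S _ => (hX K) S`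
(`poitouTate_shaRestricted_tateDual_natural_iff_forall_at`); it is not restated here.

HONEST FRAMING: CONDITIONAL on `hX` (a named statement); closes nothing; no summit statement, no case of
BSD, of Poitou–Tate duality or of Greenberg's propositions is proved here.

References: [Greenberg2016Selmer] Prop. 2.6.3 (c) (§2.6 p. 10); [Greenberg2010] Prop. 3.2.1 (c) and its proof
(p. 15 L19–32), §2.1 (6), §3.1; [MilneADT2006] I Thm. 4.10 (a) (p. 57), §4 p. 65.
-/

noncomputable section

open scoped Classical
open Function CategoryTheory NumberField IsDedekindDomain Field IsLocalRing
open _root_.TopRep _root_.ContRepresentation _root_.ContinuousCohomology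
open Literature.NumberTheory.GaloisRepresentations
open Literature.NumberTheory.GaloisRepresentations.DiscreteGaloisModule
open Literature.NumberTheory.GaloisRepresentations.DiscreteGaloisModule.TorsionLayers
open Literature.NumberTheory.GaloisCohomology
open Literature.NumberTheory.IwasawaTheory.Greenberg2006
open Literature.NumberTheory.IwasawaTheory.Greenberg2016

set_option linter.dupNamespace false
set_option autoImplicit false

namespace Summit.BirchSwinnertonDyer.BirchSwinnertonDyer.Theorems.SurLambda

open Summit.BirchSwinnertonDyer.BirchSwinnertonDyer.Theorems.SchneiderFreeAdditiveX3.PoitouTateReduction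
  (unramifiedOrthogonal_of_isPerfect_allLevels)

/-- **Greenberg 2016 Prop. 2.6.3 (c) / Greenberg 2010 Prop. 3.2.1 (c) at totally complex `K`, FROM the
natural restricted Poitou–Tate Ш-duality AT FINITE SETS OF PLACES of totally complex fields** (Milne ADT I
Thm. 4.10 (a), natural form, pointwise: `poitouTate_shaRestricted_tateDual_natural_at K S` for `S` finite):
the tree's case-(c) assembly modulo (γ) (`prop263_sur_of_crk_caseC_tc_of_dualSha_torsion`) composed with (γ)
at the canonical invariant maps (`Greenberg2016.dualSha_torsion_of_poitouTateAt`, fed `hX K S hS`).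
[cite: Greenberg2016Selmer, Prop. 2.6.3 (c) (§2.6 p. 10 L13–22)] [cite: Greenberg2010, Prop. 3.2.1 (c) and proof (p. 15 L19–32)]
[cite: MilneADT2006, Ch. I, Thm. 4.10 (a) p. 57, §4 p. 65] -/
theorem prop263_sur_of_crk_caseC_tc_of_poitouTateNaturalAt
    (hX : ∀ (K : Type) [Field K] [NumberField K] [IsTotallyComplex K]
      (S : Set (HeightOneSpectrum (𝓞 K))), S.Finite → poitouTate_shaRestricted_tateDual_natural_at K S) :
    prop263_sur_of_crk_caseC_tc := by
  refine prop263_sur_of_crk_caseC_tc_of_dualSha_torsion ?_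
  intro p _ K _ _ _ S hS hSp Λ _ _ _ _ m e D _ _ _ _ _ ρ hD _hdiv hLEO y hy
  haveI : Finite (SigmaPlace S) := (finite_setOf_inSigma S hS).to_subtype
  haveI : CompactSpace (absoluteGaloisGroup K) := absoluteGaloisGroup_compactSpace _
  exact dualSha_torsion_of_poitouTateAt ρ e hD (hX K S hS)
    (fun k => LocalInvariants.canonical K (p ^ k))
    (fun v => invLevelLaw_canonical (K := K) (p := p) v)
    (fun k => unramifiedOrthogonal_of_isPerfect_allLevels _ LocalInvariants.canonical_isPerfect)
    hSp hLEO y hy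

end Summit.BirchSwinnertonDyer.BirchSwinnertonDyer.Theorems.SurLambda

end
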